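import Summits.CriticalPhenomena.CardyFormulaZ2.Theorems.CardySelfDualSegmentSegmentClosedStubInscribedTB
import Literature.Probability.Percolation.QuadCrossingSquareModel
import Literature.Probability.LatticeModels.IsoradialPercolation
import HarnessLib

/-!
# Sub-goal `stub_boxBoundsLeCrude` of line `Sketch` (crux `UniformMarginality`, stmt-CriticalPhenomena-5472)

Route `CardySelfDualSegment` of `CriticalPhenomena/CardyFormulaZ2`, crux `UniformMarginality`
(stmt-CriticalPhenomena-5472), line `Sketch`: the t-uniformity merger "quantitative marginality at
ONE tall rectangle `Q₀ = (0, 1) × (0, 4)` + pointwise box crossing for every corner model `M_t`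
⟹ `UniformBoxCrossing`". This file proves its LOWER SANDWICH `stub_boxBoundsLeCrude` at the base
parameter `t₀`: if `M_{t₀} = cornerPercolation t₀` satisfies the box-crossing bounds
`BoxCrossingBounds (cornerPercolation t₀) squareLatticeEmbedding.z 9 c n₀` at aspect ratio `9`,
then for every mesh `δ = 1/m` with `2 n₀ + 2 ≤ m` and `10 ≤ m` the crude crossing probability
`cornerCrossingProb t₀ Q₀ (1/m)` of the model rectangle `Q₀ = rectQuad 0 1 0 4` (an open path of
`M_{t₀}` drawn on `√2 ℤ²` and rescaled by `δ`, all of whose vertices lie in the open rectangle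
`(0, 1) × (0, 4)`, from within `2δ` of the bottom side `arc 0` to within `2δ` of the top side
`arc 2`) is at least `c`.

Proof (every ingredient is a tree theorem):
* `cornerCrossingProb_eq` rewrites the right side as the `M_{t₀}`-probability of the crude
  crossing event `embDomainCrossing squareLatticeEmbedding.z Q₀.carrier δ (Q₀.arc 0) (Q₀.arc 2)`.
* The box-crossing bound at the scale `n' = ⌊m/2⌋ ≥ n₀` and the translation
  `w = ((1/4)/δ) + (0/δ) i` gives `c ≤ M_{t₀}(TB(w + [0, n'] × [0, 9 n']))` (vertical crossing of
  the translated Euclidean box).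
* Inscribed box (`stub_inscribedTB` with `x₁ = 1/4`, `x₂ = 3/4`, `y₁ = 0`, `y₂ = 4`, `a = n'`,
  `b = 9 n'`): the box `[1/4, 3/4] × (0, 4)` lies in `Q₀`, its points of height `≤ 2δ` are within
  `2δ` of the bottom side (the foot `(re p, 0)` lies on `arc 0`, `Metric.infDist_le_dist_of_mem`,
  `Complex.dist_of_re_eq`), its points of height `≥ 4 - 2δ` are within `2δ` of the top side (the
  head `(re p, 4)` lies on `arc 2`), `4δ ≤ 4`, `n' ≤ (3/4 - 1/4)/δ = m/2` and
  `(4 - 0)/δ = 4m ≤ 9 n'` (as `2 n' + 1 ≥ m ≥ 10`); so on lattice configurations the vertical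
  crossing of the translated box is a crude crossing of `Q₀`.
* `M_{t₀}` is carried by lattice configurations (`cornerPercolation_subset_edgeSet`), so the
  inclusion is an inequality of probabilities (`cornerPercolation_real_mono_of_lattice''`), and the
  two inequalities chain.
-/

noncomputable section

open Set Filter Metric MeasureTheory Complex
open scoped Topology
open Literature.Probability.RandomPlanarGeometry Literature.Probability.Percolation
open Literature.Probability.LatticeModels
open Summit.CriticalPhenomena.CardyFormulaZ2.Cruxes.SegmentClosed.Sketch (stub_gateTB stub_inscribedTB)

namespace Summit.CriticalPhenomena.CardyFormulaZ2.Cruxes.UniformMarginality.HeatFlow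

/-- `M_t` is carried by lattice configurations (`cornerPercolation_subset_edgeSet`), so an
inclusion of events valid on lattice configurations gives an inequality of `M_t`-probabilities.
(Private double-primed copy of the line's `cornerPercolation_real_mono_of_lattice`.) -/
private theorem cornerPercolation_real_mono_of_lattice'' (t : unitInterval)
    {E F : Set (BondConfig (Site 2))}
    (h : ∀ ω : BondConfig (Site 2), ω ⊆ (zdGraph 2).edgeSet → ω ∈ E → ω ∈ F) :
    (cornerPercolation t).real E ≤ (cornerPercolation t).real F := by
  simp only [measureReal_def]
  refine ENNReal.toReal_mono (measure_ne_top _ _) (measure_mono_ae ?_)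
  filter_upwards [cornerPercolation_subset_edgeSet t] with ω hω hE
  exact h ω hω hE

/-- **Lower sandwich: the box-crossing bound at `t₀` bounds the crude crossing probability of
`Q₀ = (0, 1) × (0, 4)` from below.** If `M_{t₀} = cornerPercolation t₀` satisfies the box-crossing
bounds at aspect ratio `9` with constants `c, n₀`, then for every mesh `1/m` with `2 n₀ + 2 ≤ m` and
`10 ≤ m` the crude `M_{t₀}`-crossing probability of the model rectangle `Q₀` at mesh `1/m` is at
least `c`: the vertical crossing of the translated Euclidean box
`(1/4)/δ + [0, n'] × [0, 9 n']`, `n' = ⌊m/2⌋ ≥ n₀`, has probability `≥ c`, and on lattice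
configurations it is a crude crossing of `Q₀` (`stub_inscribedTB`: the box `[1/4, 3/4] × (0, 4)` is
inscribed in `Q₀` with its bottom rows `2δ`-close to the bottom side and its top rows `2δ`-close to
the top side). -/
theorem stub_boxBoundsLeCrude : ∀ (t₀ : unitInterval) (c : ℝ) (n₀ m : ℕ), BoxCrossingBounds (cornerPercolation t₀) squareLatticeEmbedding.z 9 c n₀ → 2 * n₀ + 2 ≤ m → 10 ≤ m → c ≤ cornerCrossingProb t₀ (rectQuad 0 1 0 4 one_pos four_pos) (1 / (m : ℝ)) := by
  intro t₀ c n₀ m hBox hm hm'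
  -- the scale `n' = ⌊m/2⌋` of the inscribed box, as an opaque natural number
  obtain ⟨n', hn'⟩ : ∃ n' : ℕ, n' = m / 2 := ⟨_, rfl⟩
  have hn₀ : n₀ ≤ n' := by omega
  have h2n' : 2 * n' ≤ m := by omega
  have h9n' : 4 * m ≤ 9 * n' := by omega
  have hm0 : (0 : ℝ) < m := by exact_mod_cast (show 0 < m by omega)
  have hm1 : (1 : ℝ) ≤ m := by exact_mod_cast (show 1 ≤ m by omega)
  have h2n'R : 2 * (n' : ℝ) ≤ m := by exact_mod_cast h2n'
  have h9n'R : 4 * (m : ℝ) ≤ 9 * n' := by exact_mod_cast h9n'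
  have hδ : (0 : ℝ) < 1 / (m : ℝ) := one_div_pos.2 hm0
  have hδ1 : 1 / (m : ℝ) ≤ 1 := (div_le_one hm0).2 hm1
  -- Step 1: `P_{t₀}(Q₀, 1/m)` is the `M_{t₀}`-probability of the crude crossing event
  rw [Literature.Probability.Percolation.cornerCrossingProb_eq]
  -- Step 2: the box-crossing lower bound for the vertical crossing of the translated box
  -- `w + [0, n'] × [0, 9 n']`, `w = (1/4)/δ + (0/δ) i`, chained with the inclusion of events
  refine ((hBox n' hn₀ ((((1 / 4 : ℝ) / (1 / (m : ℝ)) : ℝ) : ℂ) +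
    (((0 : ℝ) / (1 / (m : ℝ)) : ℝ) : ℂ) * I)).2.1).trans
    (cornerPercolation_real_mono_of_lattice'' t₀ fun ω hω h => ?_)
  -- Step 3: the inscribed box `[1/4, 3/4] × (0, 4)` of `Q₀`
  refine stub_inscribedTB _ _ _ (δ := 1 / (m : ℝ)) (x₁ := 1 / 4) (x₂ := 3 / 4) (y₁ := 0)
    (y₂ := 4) (a := (n' : ℝ)) (b := 9 * (n' : ℝ)) hδ ?_ ?_ ?_ ?_ (Nat.cast_nonneg n') ?_ ?_ ω hω h
  · -- the box lies in the open rectangle `(0, 1) × (0, 4)`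
    intro p h1 h2 h3 h4
    rw [mem_rectQuad_carrier]
    exact ⟨⟨by linarith, by linarith⟩, h3, h4⟩
  · -- points of height in `(0, 2δ]` are within `2δ` of the bottom side (foot `(re p, 0)`)
    intro p h1 h2 h3 h4
    have ha : (⟨p.re, 0⟩ : ℂ) ∈ (rectQuad 0 1 0 4 one_pos four_pos).arc 0 := by
      rw [mem_rectQuad_arc_zero]
      exact ⟨rfl, show (0 : ℝ) ≤ p.re by linarith, show p.re ≤ (1 : ℝ) by linarith⟩
    calc infDist p ((rectQuad 0 1 0 4 one_pos four_pos).arc 0) ≤ dist p ⟨p.re, 0⟩ :=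
          infDist_le_dist_of_mem ha
      _ = |p.im - 0| :=
          (dist_of_re_eq (z := p) (w := ⟨p.re, 0⟩) rfl).trans (Real.dist_eq _ _)
      _ ≤ 2 * (1 / (m : ℝ)) := by
          rw [sub_zero, abs_of_pos h3]
          linarith
  · -- points of height in `[4 - 2δ, 4)` are within `2δ` of the top side (head `(re p, 4)`)
    intro p h1 h2 h3 h4
    have hb : (⟨p.re, 4⟩ : ℂ) ∈ (rectQuad 0 1 0 4 one_pos four_pos).arc 2 := by
      rw [mem_rectQuad_arc_two]
      exact ⟨rfl, show (0 : ℝ) ≤ p.re by linarith, show p.re ≤ (1 : ℝ) by linarith⟩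
    calc infDist p ((rectQuad 0 1 0 4 one_pos four_pos).arc 2) ≤ dist p ⟨p.re, 4⟩ :=
          infDist_le_dist_of_mem hb
      _ = |p.im - 4| :=
          (dist_of_re_eq (z := p) (w := ⟨p.re, 4⟩) rfl).trans (Real.dist_eq _ _)
      _ ≤ 2 * (1 / (m : ℝ)) := by
          rw [abs_sub_comm, abs_of_pos (show (0 : ℝ) < 4 - p.im by linarith)]
          linarith
  · -- the box is at least `4δ` tall: `0 + 4δ ≤ 4`
    linarith
  · -- the width: `n' ≤ (3/4 - 1/4)/δ = m/2`
    rw [le_div_iff₀ hδ, mul_one_div, div_le_iff₀ hm0]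
    linarith
  · -- the height: `(4 - 0)/δ = 4 m ≤ 9 n'`
    rw [div_le_iff₀ hδ, mul_one_div, le_div_iff₀ hm0]
    linarith

end Summit.CriticalPhenomena.CardyFormulaZ2.Cruxes.UniformMarginality.HeatFlow

end
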